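import Summits.HodgeConjecture.HodgeConjecture.Theorems.Ring2BindersVariationalHodgeQP
import Summits.HodgeConjecture.HodgeConjecture.Theorems.WeilTypeLadderVariationalLocal
import HarnessLib

/-!
# Ring 2 — binder seat b02 (Hodge ladder stage 3), junction for row b02: `AbelianSchemeVHC` is LOCAL ON THE BASE,
# and over affine bases it is reached by any germ engine and by the printed-carrier node, modulo one named residual

HONEST FRAMING: research route conditional on HC_CM; not a corollary; Q11.4-sentence-2 already refuted in dim ≥ 3.

Cell `pub-hodge-ring2`, Hodge ladder stage 3, binder seat `ring2-b02` (row b02 of `BINDER-OWNERS.md`: the named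
hypothesis `Ring2.Hypotheses.AbelianSchemeVHC`, `Theorems/Ring2Hypotheses.lean` — Grothendieck's variational Hodge
conjecture in global-class form along smooth projective families ALL OF WHOSE FIBRES ARE ABELIAN VARIETIES, over
ALL smooth irreducible bases; OPEN, print-equivalent to `HC_AV`, nothing to discharge). `HC_CM` is not mentioned in
any statement below; nothing here is a case of the Hodge conjecture; no definition, no named fact, no `sorry`;
nothing is discharged and no number of `BINDER-OWNERS.md` moves. This file supplies, for row b02, the sub-item the
dictionary owner catalogued as its one genuine lemma (`BINDER-OWNERS.md` §5.3 (v4): "global-class `AbelianSchemeVHC`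
is local on the base … general smooth irreducible S ⟸ quasi-projective opens; makes part XXVII bite on b02"), and
the two edges it unlocks. Every engine is the tree's and is used BY NAME (count once):

* (L1) `abelianSchemeVHC_of_affine`, (L1′) `abelianSchemeVHC_iff_affine` — **row b02 IS its own restriction to
  smooth irreducible AFFINE bases.** The AnchorTransport route's `Q`-stable reduction
  `Theorems.variationalHodge_of_affine_of_stable` (chain of affine opens through closed points of their
  intersections on the irreducible Jacobson base; base change `Motives.familyPullback`; data, anchor and conclusion
  moved across `fiberOverFamilyPullbackIso`) with `Q f` := "every complex fibre of `f` is (the variety underlying)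
  an abelian variety" — stable under every base change (`abelianFibres_familyPullback`), the dimension clause being
  recovered from the family (`dim_eq_of_iso_fiberOver`). Neither separatedness nor quasi-compactness of the base is
  needed, and no quasi-projectivity of anything.
* (L2) `abelianSchemeVHC_conclusion_of_germ`, (L2′) `abelianSchemeVHC_of_germ_of_abelianTotalQuasiProjective`,
  (L2″) `abelianSchemeVHC_iff_germ_of_abelianTotalQuasiProjective` — **LOCAL ⟹ GLOBAL for row b02.** If on
  abelian-fibred smooth projective families with quasi-projective total space over smooth irreducible AFFINE bases ONE
  algebraic fibre of a fibrewise-Hodge global class always forces a NON-EMPTY EUCLIDEAN-OPEN set of algebraic fibres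
  (the output shape of every deformation-theoretic engine: Bloch 1972 Thm. 7.4, Buchweitz–Flenner 2003 Thm. 5.1, the
  cell's `LocalVHCAtCM` at CM anchors, `WeilTypeLadder.AbelianSchemeVHCGerm k` at `(n, p) = (2k, k)`), then the class
  is algebraic on EVERY fibre (the WeilTypeLadder's `mem_algebraicClasses_of_isOpen_subset_algebraicityLocus`:
  Charles–Schnell's countable union of Zariski-closed algebraicity loci + Baire + Mumford's curve lemma, all
  discharged in the tree; an affine `ℂ`-scheme of finite type is quasi-projective, `IsQuasiProjectiveOver.of_isAffine`)
  — per family (L2); hence row b02 itself granted the residual `AbelianTotalQuasiProjective[]` (L2′), and modulo that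
  residual row b02 is EQUIVALENT to its germ form (L2″; `→` takes the whole base as the open set).
* (L3) `abelianSchemeVHC_of_variationalHodgeQP_of_abelianTotalQuasiProjective` — **part XXVII's printed-carrier node
  `VariationalHodgeQP` (Charles–Schnell Conj. 11.3.1 verbatim carriers) reaches row b02 granted the SAME residual**
  ((L1) + seat b03's junction (J1) `Binders.variationalHodge_quasiProjective_of_variationalHodgeQP`); compare seat
  b03's (J3), which needs the residual for ALL smooth proper families with projective fibres (false in general:
  Atiyah-flop families) — for row b02 only abelian-fibred families enter.

THE RESIDUAL `AbelianTotalQuasiProjective[]` (local notation, displayed as a hypothesis wherever used, NEVER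
asserted): the total space of a smooth proper family with abelian-variety fibres over a smooth irreducible affine
`ℂ`-scheme is quasi-projective over `ℂ`. Print status: for ABELIAN SCHEMES (zero section, group law) over a normal
noetherian base, projectivity is a theorem (Görtz–Wedhorn II Thm. 27.291, after Raynaud; the normality hypothesis
cannot be dropped — Raynaud's example over a non-normal local ring, loc. cit., remark after the proof); the tree's
typing is SECTION-FREE (`Motives.IsSmoothProjectiveFamily` = smooth of relative dimension `n` + proper + smooth
projective fibres, each complex fibre isomorphic to the variety underlying SOME abelian variety; no group law, no
section), to which that theorem does not apply verbatim, and we assert nothing. It is the abelian-fibre SPECIAL CASE of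
the AnchorTransport residual `hqp` of `Theorems.variationalHodge_of_projective_of_isQuasiProjectiveOver`, whose
blanket form is false (Atiyah-flop families), and it is the exact difference between row b02 AS TYPED and row b02 on
the printed (quasi-projective) carriers.

What is NOT claimed: the residual; any case of `AbelianSchemeVHC`; anything about `HC_AV` or `HC_CM` (row b02's
arrows are part I §1c–§1d and deform IV, unchanged: OPEN ≡ `HC_AV` modulo print, «10 · 0» untouched).

References: [Grothendieck1966] footnote 13; [CharlesSchnell2014Notes] Conj. 11.3.1 (= arXiv:1101.3647 Conj. 30),
Prop. 11.3.5, proof of Prop. 11.3.11 (Hilbert schemes: the algebraicity locus is a countable union of closed algebraic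
subsets); [Deligne1982HodgeCycles] Milne's 2003 re-edition, endnote 19 ((VHC) for abelian varieties);
[MumfordAV1970] §6 Lemma (curve through two points); [Hartshorne1977] II §4 p. 103 (quasi-projective morphisms),
II Ex. 3.20 / III.10 (dimension); [GortzWedhorn2023] Thm. 27.291 (abelian schemes over normal noetherian bases are
projective) and the remark following its proof; [Bloch1972Semiregularity] Thm. 7.4; [BuchweitzFlenner2003] Thm. 5.1.
-/

-- every declaration of this problem lives in `Summit.HodgeConjecture.HodgeConjecture.…` (summit = sub-problem);
-- namespace `…Ring2.Binders` = the binder seats of the cell's Hodge-ladder stage 3 (`BINDER-OWNERS.md`)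
set_option linter.dupNamespace false

noncomputable section

open CategoryTheory AlgebraicGeometry
open Literature.AlgebraicGeometry Literature.AlgebraicGeometry.Motives
open Literature.AlgebraicGeometry.HodgeTheory

namespace Summit.HodgeConjecture.HodgeConjecture.Ring2.Binders

open Summit.HodgeConjecture.HodgeConjecture.Ring2.Hypotheses

/-- `AbelianSchemeVHCAffine[]` — row b02 `Ring2.Hypotheses.AbelianSchemeVHC` with its base restricted to smooth
irreducible AFFINE `ℂ`-schemes (symbol for symbol the body of `AbelianSchemeVHC` plus the clause `IsAffine S.left`).
Local notation only (no definition is introduced). -/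
local notation3 (prettyPrint := false) "AbelianSchemeVHCAffine[]" =>
  ∀ ⦃n : ℕ⦄ ⦃𝒳 S : SchemeOver ℂ⦄ (f : 𝒳 ⟶ S), IsSmoothProjectiveFamily f n → IrreducibleSpace S.left →
    IsAffine S.left → AlgebraicGeometry.Smooth S.hom →
    (∀ s : ComplexPoints S, ∃ A' : AbelianVariety ℂ, A'.dim = n ∧ Nonempty (A'.X ≅ fiberOver f s)) →
    ∀ (p : ℕ) (W : complexBetti 𝒳 (2 * p)),
      (∀ s : ComplexPoints S, IsRationalClass (complexBetti.map (fiberι f s) (2 * p) W) ∧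
        IsOfHodgeType n (fiberOver f s) (2 * p) p p (complexBetti.map (fiberι f s) (2 * p) W)) →
      (∃ s₀ : ComplexPoints S,
        complexBetti.map (fiberι f s₀) (2 * p) W ∈ algebraicClasses (fiberOver f s₀) p) →
      ∀ s : ComplexPoints S, complexBetti.map (fiberι f s) (2 * p) W ∈ algebraicClasses (fiberOver f s) p

/-- `AbelianSchemeVHCGermAffine[]` — the GERM form of row b02 on engine-ready carriers: abelian-fibred smooth
projective families with QUASI-PROJECTIVE total space over smooth irreducible AFFINE bases; one algebraic fibre of a
fibrewise rational `(p,p)` global class forces a non-empty Euclidean-open set of algebraic fibres around it (the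
output shape of Bloch 1972 Thm. 7.4 / Buchweitz–Flenner 2003 Thm. 5.1; `WeilTypeLadder.AbelianSchemeVHCGerm k` is
its instance `(n, p) = (2k, k)` up to the base clause). OPEN as a blanket statement; a HYPOTHESIS below, never
asserted. Local notation only. -/
local notation3 (prettyPrint := false) "AbelianSchemeVHCGermAffine[]" =>
  ∀ ⦃n : ℕ⦄ ⦃𝒳 S : SchemeOver ℂ⦄ (f : 𝒳 ⟶ S), IsSmoothProjectiveFamily f n → IsQuasiProjectiveOver 𝒳 →
    IrreducibleSpace S.left → IsAffine S.left → AlgebraicGeometry.Smooth S.hom →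
    (∀ s : ComplexPoints S, ∃ A' : AbelianVariety ℂ, A'.dim = n ∧ Nonempty (A'.X ≅ fiberOver f s)) →
    ∀ (p : ℕ) (W : complexBetti 𝒳 (2 * p)),
      (∀ s : ComplexPoints S, IsRationalClass (complexBetti.map (fiberι f s) (2 * p) W) ∧
        IsOfHodgeType n (fiberOver f s) (2 * p) p p (complexBetti.map (fiberι f s) (2 * p) W)) →
      ∀ s₀ : ComplexPoints S,
        complexBetti.map (fiberι f s₀) (2 * p) W ∈ algebraicClasses (fiberOver f s₀) p →
        ∃ U : Set (ComplexPoints S), IsOpen U ∧ s₀ ∈ U ∧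
          ∀ s ∈ U, complexBetti.map (fiberι f s) (2 * p) W ∈ algebraicClasses (fiberOver f s) p

/-- `AbelianTotalQuasiProjective[]` — THE RESIDUAL of this file: the total space of a smooth proper family with
abelian-variety fibres (tree typing: smooth of relative dimension `n`, proper, smooth projective fibres, every complex
fibre isomorphic to the variety underlying an abelian variety — no section, no group law) over a smooth irreducible
AFFINE `ℂ`-scheme is quasi-projective over `ℂ`. In print, abelian SCHEMES (with zero section) over a normal
noetherian base are projective [cite: GortzWedhorn2023, Thm. 27.291] (after Raynaud; false over non-normal bases,
remark following the proof); that theorem does not apply verbatim to the section-free typing and nothing is asserted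
here. The abelian-fibre special case of the AnchorTransport residual `hqp` (whose blanket form is false, Atiyah-flop
families). A HYPOTHESIS below, never asserted. Local notation only. -/
local notation3 (prettyPrint := false) "AbelianTotalQuasiProjective[]" =>
  ∀ ⦃n : ℕ⦄ ⦃𝒳 S : SchemeOver ℂ⦄ (f : 𝒳 ⟶ S), IsSmoothProjectiveFamily f n → IrreducibleSpace S.left →
    IsAffine S.left → AlgebraicGeometry.Smooth S.hom →
    (∀ s : ComplexPoints S, ∃ A' : AbelianVariety ℂ, A'.dim = n ∧ Nonempty (A'.X ≅ fiberOver f s)) →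
    IsQuasiProjectiveOver 𝒳

/-! ## §0 Abelian fibres under base change -/

/-- **An abelian fibre of a smooth projective family of relative dimension `n` has dimension `n`**: the fibre is a
smooth projective `n`-fold (`IsSmoothProjectiveFamily.isSmoothProjective`), hence so is `A'.X`
(`IsSmoothProjective.of_iso`), whose dimension is `n` (`Motives.schemeDim_eq_holds`). [cite: Hartshorne1977, II Ex. 3.20 and III.10] -/
theorem dim_eq_of_iso_fiberOver {n : ℕ} {𝒳 S : SchemeOver ℂ} {f : 𝒳 ⟶ S} (hf : IsSmoothProjectiveFamily f n)
    {s : ComplexPoints S} {A' : AbelianVariety ℂ} (e : A'.X ≅ fiberOver f s) : A'.dim = n :=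
  schemeDim_eq_holds ((hf.isSmoothProjective s).of_iso e.symm)

/-- **"Every complex fibre is an abelian variety" is stable under every base change** `g : S' ⟶ S`: the fibre of
`𝒳 ×_S S' ⟶ S'` over `s'` is the fibre of `f` over `g(s')` (`fiberOverFamilyPullbackIso`). [folklore] -/
theorem abelianFibres_familyPullback {𝒳 S S' : SchemeOver ℂ} (f : 𝒳 ⟶ S) (g : S' ⟶ S)
    (h : ∀ s : ComplexPoints S, ∃ A' : AbelianVariety ℂ, Nonempty (A'.X ≅ fiberOver f s))
    (s' : ComplexPoints S') :
    ∃ A' : AbelianVariety ℂ, Nonempty (A'.X ≅ fiberOver (familyPullback.snd f g) s') := by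
  obtain ⟨A', ⟨e⟩⟩ := h (AlgPoints.map g s')
  exact ⟨A', ⟨e ≪≫ (fiberOverFamilyPullbackIso f g s').symm⟩⟩

/-- The abelian-fibre clause of row b02 with and without its (redundant) dimension clause. [folklore] -/
theorem abelianFibres_iff_of_isSmoothProjectiveFamily {n : ℕ} {𝒳 S : SchemeOver ℂ} {f : 𝒳 ⟶ S}
    (hf : IsSmoothProjectiveFamily f n) :
    (∀ s : ComplexPoints S, ∃ A' : AbelianVariety ℂ, A'.dim = n ∧ Nonempty (A'.X ≅ fiberOver f s)) ↔
      ∀ s : ComplexPoints S, ∃ A' : AbelianVariety ℂ, Nonempty (A'.X ≅ fiberOver f s) := by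
  refine ⟨fun h s => ?_, fun h s => ?_⟩
  · obtain ⟨A', -, hA'⟩ := h s
    exact ⟨A', hA'⟩
  · obtain ⟨A', ⟨e⟩⟩ := h s
    exact ⟨A', dim_eq_of_iso_fiberOver hf e, ⟨e⟩⟩

/-! ## §1 Row b02 is local on the base (BINDER-OWNERS §5.3 (v4)) -/

/-- **(L1) Row b02 reduces to smooth irreducible AFFINE bases.** If the variational Hodge statement for
abelian-fibred smooth projective families holds over smooth irreducible affine `ℂ`-schemes, it holds over every smooth
irreducible `ℂ`-scheme: the AnchorTransport route's `Q`-stable reduction `Theorems.variationalHodge_of_affine_of_stable`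
with `Q f` := "every complex fibre of `f` is an abelian variety" (stable under base change,
`abelianFibres_familyPullback`; the dimension clause is recovered by `dim_eq_of_iso_fiberOver`). No separatedness,
quasi-compactness or quasi-projectivity of anything is used. [cite: Grothendieck1966, footnote 13]
[cite: CharlesSchnell2014Notes, Conj. 11.3.1] -/
theorem abelianSchemeVHC_of_affine (h : AbelianSchemeVHCAffine[]) : AbelianSchemeVHC := by
  intro n 𝒳 S f hf hirr hsm habel p W hW h₀ s
  exact Theorems.variationalHodge_of_affine_of_stable
    (fun _ S' f' => ∀ s' : ComplexPoints S', ∃ A' : AbelianVariety ℂ, Nonempty (A'.X ≅ fiberOver f' s'))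
    (fun _ _ _ f' g _ hQ => abelianFibres_familyPullback f' g hQ)
    (fun _ _ _ f' hf' hQ hirr' haff hsm' =>
      h f' hf' hirr' haff hsm' ((abelianFibres_iff_of_isSmoothProjectiveFamily hf').2 hQ))
    f hf ((abelianFibres_iff_of_isSmoothProjectiveFamily hf).1 habel) hirr hsm p W hW h₀ s

/-- Restriction: row b02 gives its affine-base form (forget `IsAffine`). [folklore] -/
theorem abelianSchemeVHCAffine_of_abelianSchemeVHC (h : AbelianSchemeVHC) : AbelianSchemeVHCAffine[] :=
  fun _ _ _ f hf hirr _ hsm habel p W hW h₀ s => h f hf hirr hsm habel p W hW h₀ s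

/-- **(L1′) EXACTNESS: row b02 `AbelianSchemeVHC` IS its restriction to smooth irreducible affine bases.**
[cite: Grothendieck1966, footnote 13] [cite: CharlesSchnell2014Notes, Conj. 11.3.1] -/
theorem abelianSchemeVHC_iff_affine : AbelianSchemeVHC ↔ AbelianSchemeVHCAffine[] :=
  ⟨abelianSchemeVHCAffine_of_abelianSchemeVHC, abelianSchemeVHC_of_affine⟩

/-! ## §2 LOCAL ⟹ GLOBAL for row b02 -/

/-- **(L2) On ONE abelian-fibred family with quasi-projective total space over a smooth irreducible affine base, the
germ form gives the conclusion of row b02**: the base is quasi-projective (`IsQuasiProjectiveOver.of_isAffine`), the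
algebraicity locus of `W` contains a Euclidean-open neighbourhood of the anchor (the germ hypothesis), hence is all of
`S(ℂ)` (`WeilTypeLadder.mem_algebraicClasses_of_isOpen_subset_algebraicityLocus`: countable union of Zariski-closed
loci, Baire, Mumford's curve lemma — tree theorems). [cite: CharlesSchnell2014Notes, Prop. 11.3.11 (proof)]
[cite: MumfordAV1970, §6, Lemma] -/
theorem abelianSchemeVHC_conclusion_of_germ (hG : AbelianSchemeVHCGermAffine[])
    {n : ℕ} {𝒳 S : SchemeOver ℂ} (f : 𝒳 ⟶ S) (hf : IsSmoothProjectiveFamily f n) (h𝒳 : IsQuasiProjectiveOver 𝒳)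
    [hirr : IrreducibleSpace S.left] [haff : IsAffine S.left] [hsm : AlgebraicGeometry.Smooth S.hom]
    (habel : ∀ s : ComplexPoints S, ∃ A' : AbelianVariety ℂ, A'.dim = n ∧ Nonempty (A'.X ≅ fiberOver f s))
    (p : ℕ) (W : complexBetti 𝒳 (2 * p))
    (hW : ∀ s : ComplexPoints S, IsRationalClass (complexBetti.map (fiberι f s) (2 * p) W) ∧
      IsOfHodgeType n (fiberOver f s) (2 * p) p p (complexBetti.map (fiberι f s) (2 * p) W))
    (h₀ : ∃ s₀ : ComplexPoints S, complexBetti.map (fiberι f s₀) (2 * p) W ∈ algebraicClasses (fiberOver f s₀) p)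
    (s : ComplexPoints S) :
    complexBetti.map (fiberι f s) (2 * p) W ∈ algebraicClasses (fiberOver f s) p := by
  obtain ⟨s₀, hs₀⟩ := h₀
  obtain ⟨U, hUo, hs₀U, hUalg⟩ := hG f hf h𝒳 hirr haff hsm habel p W hW s₀ hs₀
  haveI : LocallyOfFiniteType S.hom := inferInstance
  exact WeilTypeLadder.mem_algebraicClasses_of_isOpen_subset_algebraicityLocus f h𝒳
    (IsQuasiProjectiveOver.of_isAffine S) hsm hf W hUo ⟨s₀, hs₀U⟩ hUalg s

/-- **(L2′) Row b02 from its GERM form, granted the residual `AbelianTotalQuasiProjective[]`**: reduce to affine bases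
(L1), where the total space is quasi-projective by the residual and (L2) applies. So row b02 is "any
deformation-theoretic density engine on abelian fibres over affine bases" + the residual, nothing else.
[cite: CharlesSchnell2014Notes, Conj. 11.3.1 and Prop. 11.3.11 (proof)] [cite: Bloch1972Semiregularity, Thm. 7.4]
[cite: BuchweitzFlenner2003, Thm. 5.1] -/
theorem abelianSchemeVHC_of_germ_of_abelianTotalQuasiProjective (hqp : AbelianTotalQuasiProjective[])
    (hG : AbelianSchemeVHCGermAffine[]) : AbelianSchemeVHC :=
  abelianSchemeVHC_of_affine fun _ _ _ f hf hirr haff hsm habel p W hW h₀ s =>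
    abelianSchemeVHC_conclusion_of_germ hG f hf (hqp f hf hirr haff hsm habel) habel p W hW h₀ s

/-- Row b02 gives its germ form outright (the open set is the whole base). [folklore] -/
theorem abelianSchemeVHCGermAffine_of_abelianSchemeVHC (h : AbelianSchemeVHC) : AbelianSchemeVHCGermAffine[] :=
  fun _ _ _ f hf _ hirr _ hsm habel p W hW s₀ hs₀ =>
    ⟨Set.univ, isOpen_univ, Set.mem_univ _, fun s _ => h f hf hirr hsm habel p W hW ⟨s₀, hs₀⟩ s⟩

/-- **(L2″) EXACTNESS modulo the residual: row b02 `AbelianSchemeVHC` ⟺ its germ form on engine-ready carriers.**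
[cite: CharlesSchnell2014Notes, Conj. 11.3.1 and Prop. 11.3.11 (proof)] -/
theorem abelianSchemeVHC_iff_germ_of_abelianTotalQuasiProjective (hqp : AbelianTotalQuasiProjective[]) :
    AbelianSchemeVHC ↔ AbelianSchemeVHCGermAffine[] :=
  ⟨abelianSchemeVHCGermAffine_of_abelianSchemeVHC, abelianSchemeVHC_of_germ_of_abelianTotalQuasiProjective hqp⟩

/-! ## §3 Part XXVII's printed-carrier node reaches row b02, modulo the same residual -/

/-- **(L3) `VariationalHodgeQP ⟹ AbelianSchemeVHC` granted `AbelianTotalQuasiProjective[]`.** Reduce to affine bases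
(L1); there the total space is quasi-projective by the residual, so seat b03's junction (J1)
`Binders.variationalHodge_quasiProjective_of_variationalHodgeQP` (part XXVII's node with its idle base clause removed)
concludes. Compare (J3) `Binders.vhc_of_variationalHodgeQP_of_isQuasiProjectiveOver`, which needs the residual for ALL
smooth proper families with projective fibres; for row b02 only abelian-fibred families enter.
[cite: CharlesSchnell2014Notes, Conj. 11.3.1] [cite: Deligne1982HodgeCycles, Milne 2003 re-edition endnote 19] -/
theorem abelianSchemeVHC_of_variationalHodgeQP_of_abelianTotalQuasiProjective (hqp : AbelianTotalQuasiProjective[])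
    (hV : VariationalHodgeQP) : AbelianSchemeVHC :=
  abelianSchemeVHC_of_affine fun _ _ _ f hf hirr haff hsm habel p W hW h₀ s =>
    variationalHodge_quasiProjective_of_variationalHodgeQP hV f hf (hqp f hf hirr haff hsm habel) hirr hsm p W hW h₀ s

/-- (L3, flat-section form) Charles–Schnell's Conj. 11.3.1 on its printed carriers (`FlatSectionsAlgebraicQP`, part
XXVII) reaches row b02 granted the residual (XXVII's `variationalHodgeQP_of_flatSectionsAlgebraicQP`, no fact binder).
[cite: CharlesSchnell2014Notes, Conj. 11.3.1, Thm. 11.3.4 and proof of Prop. 11.3.5] -/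
theorem abelianSchemeVHC_of_flatSectionsAlgebraicQP_of_abelianTotalQuasiProjective
    (hqp : AbelianTotalQuasiProjective[]) (hF : FlatSectionsAlgebraicQP) : AbelianSchemeVHC :=
  abelianSchemeVHC_of_variationalHodgeQP_of_abelianTotalQuasiProjective hqp
    (variationalHodgeQP_of_flatSectionsAlgebraicQP hF)

/-! ## Audit

`#print axioms` of every theorem above: `propext`, `Classical.choice`, `Quot.sound` (checked at submission). No
`sorry`, no new `def`/`axiom`/`opaque`, no Literature named fact as hypothesis other than the two displayed inline
Props `AbelianSchemeVHCGermAffine[]` (a germ form of row b02 itself) and the residual `AbelianTotalQuasiProjective[]`.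
-/

end Summit.HodgeConjecture.HodgeConjecture.Ring2.Binders

end
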